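import Summits.Ventures.PercRepro.RankLevelSetDeleteMono

/-!
# PercRepro — the three-way door: (MD′) or (MC) or (MC″) at some element (night-1, gen 11)

`c025_of_threeWayMonoExistsCore`: C-025 follows if every simple coloop-free core strictly above the tight layer has an
element `e` at which the slack of the cell does not increase under ONE of the three single-element moves —
deletion at the same cell, `σ_{M ＼ e}(p, q) ≤ σ_M(p, q)` (MD′); contraction to `(p − 1, q)`,
`σ_{M ／ e}(p − 1, q) ≤ σ_M(p, q)` (MC, C-037); contraction to `(p − 1, q − 1)`, `σ_{M ／ e}(p − 1, q − 1) ≤ σ_M(p, q)`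
(MC″).  The weakest hypothesis of this family in the tree; the induction is that of `c025_of_eitherMonoExistsCore`
with the third door closed by the induction hypothesis on `M ／ {e}` at `(p − 1, q − 1)` (Theorem A at `q − 1 = 0`).
Axioms: standard.
-/

open scoped Matroid

namespace PercRepro

namespace ThmN

open Set

variable {α : Type}

/-- **THE THREE-WAY DOOR ON CORES**: on every simple, rank-`p`, coloop-free core with every element `e`-free-partitioned,
`q ≥ 1`, `q + 2 ≤ p`, `|E| > p + q`, some `e ∈ E` satisfies (MD′), (MC) or (MC″). -/
def ThreeWayMonoExistsCore : Prop :=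
  ∀ {α : Type} (M : Matroid α) [M.Finite] (p q : ℕ), 1 ≤ q → q + 2 ≤ p →
    (∀ e ∈ M.E, ∀ f ∈ M.E, e ≠ f → M.eRk {e, f} = 2) → M.eRank = (p : ℕ∞) →
    (∀ e, ¬ M.IsColoop e) →
    (∀ e ∈ M.E, ∃ A ⊆ M.E \ {e}, e ∉ M.closure A ∧ e ∉ M.closure ((M.E \ {e}) \ A)) →
    p + q < M.E.ncard →
    ∃ e ∈ M.E, Matroid.slack (M ＼ {e}) p q ≤ Matroid.slack M p q ∨
      Matroid.slack (M ／ {e}) (p - 1) q ≤ Matroid.slack M p q ∨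
      Matroid.slack (M ／ {e}) (p - 1) (q - 1) ≤ Matroid.slack M p q

/-- The combined door of `RankLevelSetDeleteMono` implies the three-way door. -/
theorem threeWayMonoExistsCore_of_eitherMonoExistsCore (h : EitherMonoExistsCore) :
    ThreeWayMonoExistsCore := by
  intro α M _ p q hq hpq hs hR hC hU hbig
  obtain ⟨e, he, hd⟩ := h M p q hq hpq hs hR hC hU hbig
  exact ⟨e, he, hd.elim Or.inl (fun h' => Or.inr (Or.inl h'))⟩

/-- The (MC″) step: from `σ_{M ／ e}(p − 1, q − 1) ≤ σ_M(p, q)` and `RLS` of the contraction at `(p − 1, q − 1)`. -/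
theorem RLS_of_contract_slack' (M : Matroid α) [M.Finite] {p q : ℕ} {e : α}
    (hMC : Matroid.slack (M ／ {e}) (p - 1) (q - 1) ≤ Matroid.slack M p q)
    (hIH : RLS (M ／ {e}) (p - 1) (q - 1)) : RLS M p q := by
  rw [RLS_iff_slack_nonneg] at hIH ⊢
  exact le_trans hIH hMC

/-- **C-025 FROM THE THREE-WAY DOOR ON CORES.** -/
theorem c025_of_threeWayMonoExistsCore (hcore : ThreeWayMonoExistsCore) : C025 := by
  suffices H : ∀ n : ℕ, ∀ {α : Type} (M : Matroid α) [M.Finite], M.E.ncard = n → ∀ p q : ℕ, q + 2 ≤ p →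
      RLS M p q by
    intro α M _ p q hpq
    exact H _ M rfl p q hpq
  intro n
  induction n using Nat.strong_induction_on with
  | _ n ih =>
  intro α M _ hn p q hpq
  classical
  -- `q = 0` is Theorem A
  rcases Nat.eq_zero_or_pos q with hq0 | hq1
  · subst hq0
    exact c025_of_q_zero (M := M) p
  have hdel : ∀ e ∈ M.E, (M ＼ {e}).E.ncard < n := by
    intro e he
    rw [_root_.Matroid.delete_ground, ← hn, ← Set.ncard_sdiff_singleton_add_one he M.ground_finite]
    omega
  have hcon : ∀ e ∈ M.E, (M ／ {e}).E.ncard < n := by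
    intro e he
    rw [_root_.Matroid.contract_ground, ← hn, ← Set.ncard_sdiff_singleton_add_one he M.ground_finite]
    omega
  -- the core step, shared by the two branches below
  have hstep : ∀ (T : Matroid α) [T.Finite], T.E.ncard = n →
      (∀ e ∈ T.E, ∀ f ∈ T.E, e ≠ f → T.eRk {e, f} = 2) → T.eRank = (p : ℕ∞) → (∀ e, ¬ T.IsColoop e) →
      (∀ e ∈ T.E, ∃ A ⊆ T.E \ {e}, e ∉ T.closure A ∧ e ∉ T.closure ((T.E \ {e}) \ A)) →
      p + q < T.E.ncard → RLS T p q := by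
    intro T _ hTn hs hR hC hU hbig
    have hdelT : ∀ e ∈ T.E, (T ＼ {e}).E.ncard < n := by
      intro e he
      rw [_root_.Matroid.delete_ground, ← hTn, ← Set.ncard_sdiff_singleton_add_one he T.ground_finite]
      omega
    have hconT : ∀ e ∈ T.E, (T ／ {e}).E.ncard < n := by
      intro e he
      rw [_root_.Matroid.contract_ground, ← hTn, ← Set.ncard_sdiff_singleton_add_one he T.ground_finite]
      omega
    obtain ⟨e, he, hdoor⟩ := hcore T p q hq1 hpq hs hR hC hU hbig
    rcases hdoor with hMD | hMC | hMC'
    · exact RLS_of_delete_slack T hMD (ih _ (hdelT e he) (T ＼ {e}) rfl p q hpq)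
    · exact RLS_of_contract_slack T hpq hMC
        (fun hp => ih _ (hconT e he) (T ／ {e}) rfl (p - 1) q hp)
    · exact RLS_of_contract_slack' T hMC'
        (ih _ (hconT e he) (T ／ {e}) rfl (p - 1) (q - 1) (by omega))
  -- Case 1: a loop
  by_cases hL : ∃ e ∈ M.E, M.IsLoop e
  · obtain ⟨e, he, hloopE⟩ := hL
    exact RLS_of_loop_q M hloopE p q (ih _ (hdel e he) (M ＼ {e}) rfl p q hpq)
  push Not at hL
  -- Case 2: a parallel pair
  by_cases hP : ∃ e ∈ M.E, ∃ e' ∈ M.E, e' ≠ e ∧ e ∈ M.closure {e'}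
  · obtain ⟨e, he, e', he', hne, hpar⟩ := hP
    have heI : M.Indep {e} := _root_.Matroid.indep_singleton.2 ((_root_.Matroid.not_isLoop_iff he).1 (hL e he))
    obtain ⟨p', rfl⟩ : ∃ p', p = p' + 1 := ⟨p - 1, by omega⟩
    obtain ⟨q', rfl⟩ : ∃ q', q = q' + 1 := ⟨q - 1, by omega⟩
    exact RLS_of_parallel_q M heI he' hne hpar (ih _ (hdel e he) (M ＼ {e}) rfl (p' + 1) (q' + 1) hpq)
      (ih _ (hcon e he) (M ／ {e}) rfl p' q' (by omega))
  push Not at hP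
  -- Case 3: simple
  have hs : ∀ e ∈ M.E, ∀ f ∈ M.E, e ≠ f → M.eRk {e, f} = 2 :=
    fun e he f hf hef => eRk_pair_eq_two_of_simple M hL (fun e he e' he' hne => hP e he e' he' hne) he hf hef
  -- the tight layer and below: Theorem M
  rcases lt_trichotomy M.E.ncard (p + q) with hsmall | htight | hbig
  · exact RLS_of_ncard_lt M hsmall
  · exact RLS_of_ncard_eq M htight
  rcases lt_trichotomy M.eRank (p : ℕ∞) with hlt | heq | hgt
  · exact RLS_of_eRank_lt M hlt
  · -- `ρ(E) = p`
    by_cases hC : ∃ e, M.IsColoop e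
    · obtain ⟨e, hcol⟩ := hC
      obtain ⟨p', rfl⟩ : ∃ p', p = p' + 1 := ⟨p - 1, by omega⟩
      obtain ⟨q', rfl⟩ : ∃ q', q = q' + 1 := ⟨q - 1, by omega⟩
      refine RLS_of_coloop_q M (by omega) hcol heq ?_
      rcases Nat.lt_or_ge (q' + 2) p' with h | h
      · exact ih _ (hdel e hcol.mem_ground) (M ＼ {e}) rfl p' (q' + 1) (by omega)
      · exact RLS_of_le (M ＼ {e}) (by omega)
    · push Not at hC
      by_cases hU : ∃ e ∈ M.E, ∀ A ⊆ M.E \ {e}, e ∈ M.closure A ∨ e ∈ M.closure ((M.E \ {e}) \ A)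
      · obtain ⟨e, he, hunsp⟩ := hU
        have heI : M.Indep {e} := _root_.Matroid.indep_singleton.2 ((_root_.Matroid.not_isLoop_iff he).1 (hL e he))
        obtain ⟨p', rfl⟩ : ∃ p', p = p' + 1 := ⟨p - 1, by omega⟩
        obtain ⟨q', rfl⟩ : ∃ q', q = q' + 1 := ⟨q - 1, by omega⟩
        exact RLS_of_unspanned_q M heI hunsp (ih _ (hdel e he) (M ＼ {e}) rfl (p' + 1) (q' + 1) hpq)
          (ih _ (hcon e he) (M ／ {e}) rfl p' q' (by omega))
      · push Not at hU
        exact hstep M hn hs heq hC (fun e he => by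
          obtain ⟨A, hA, h⟩ := hU e he
          exact ⟨A, hA, h.1, h.2⟩) hbig
  · -- `ρ(E) > p`: truncate
    have hp2 : 2 ≤ p := by omega
    set T := Matroid.truncate M p with hTdef
    have hTs := truncate_pair_eRk M hp2 hs
    have hTR := truncate_eRank_eq M hgt
    have hTc := truncate_no_coloop M hgt
    have hTE : T.E = M.E := Matroid.truncate_ground M p
    have hTn : T.E.ncard = n := by rw [hTE, hn]
    have hTbig : p + q < T.E.ncard := by rw [hTE]; exact hbig
    have hconT : ∀ e ∈ T.E, (T ／ {e}).E.ncard < n := by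
      intro e he
      rw [_root_.Matroid.contract_ground, ← hTn, ← Set.ncard_sdiff_singleton_add_one he T.ground_finite]
      omega
    have hdelT : ∀ e ∈ T.E, (T ＼ {e}).E.ncard < n := by
      intro e he
      rw [_root_.Matroid.delete_ground, ← hTn, ← Set.ncard_sdiff_singleton_add_one he T.ground_finite]
      omega
    have hT : RLS T p q := by
      by_cases hU : ∃ e ∈ T.E, ∀ A ⊆ T.E \ {e}, e ∈ T.closure A ∨ e ∈ T.closure ((T.E \ {e}) \ A)
      · obtain ⟨e, he, hunsp⟩ := hU
        have heT : T.Indep {e} := by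
          rw [Matroid.truncate_indep_iff]
          refine ⟨_root_.Matroid.indep_singleton.2 ((_root_.Matroid.not_isLoop_iff (hTE ▸ he)).1 (hL e (hTE ▸ he))), ?_⟩
          rw [Set.ncard_singleton]; omega
        obtain ⟨p', rfl⟩ : ∃ p', p = p' + 1 := ⟨p - 1, by omega⟩
        obtain ⟨q', rfl⟩ : ∃ q', q = q' + 1 := ⟨q - 1, by omega⟩
        exact RLS_of_unspanned_q T heT hunsp (ih _ (hdelT e he) (T ＼ {e}) rfl (p' + 1) (q' + 1) hpq)
          (ih _ (hconT e he) (T ／ {e}) rfl p' q' (by omega))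
      · push Not at hU
        exact hstep T hTn hTs hTR hTc (fun e he => by
          obtain ⟨A, hA, h⟩ := hU e he
          exact ⟨A, hA, h.1, h.2⟩) hTbig
    unfold RLS at hT ⊢
    exact Matroid.rls_of_truncate M p (by omega) (phiK p q) (by unfold phiK; positivity) hT

end ThmN

end PercRepro
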